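import Summits.QuantumFields.QCD.Theses.NestedDissectionSea
import Literature.MathematicalPhysics.QuantumFieldTheory.ConstructiveQFTWave0OddRPProofs
import Literature.MathematicalPhysics.QuantumFieldTheory.LatticeGaugePlaquetteLowerBound
import Literature.MathematicalPhysics.QuantumFieldTheory.LatticeGaugeStaticPotentialProofs
import Summits.QuantumFields.YangMills.Theorems.LatticeGapOnTrajectory.Negative.ZeroCouplingGap

/-!
# `RobustYangMills` — negative-side support I: the legal GLOBAL activity `g(S_W(U))`

First of three importable extracts (cycle 1) of the standing disprover's work file
`Summits/QuantumFields/QCD/Cruxes/RobustYangMills/Disproof.lean` for the shared crux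
`Summit.QuantumFields.QCD.Theses.NestedDissectionSea.RobustYangMills` (item stmt-QuantumFields-13897;
verbatim `HeavyThresholdYMBridge.RobustYangMills`, `AdaptiveBlockFermions.RobustYangMills`).
Tree objects only; nothing posited.

* §0 torus identities (`rectangleHolonomy_one_one`, `wilsonAction_timeReflect`, `configPerm_eq`,
  `wilsonMeasure_zero_eq_pi`, `partitionFunction_ne_zero_and_ne_top`);
  `side_le_mul_card_blockCorners` / `rangeControl_of_side_le`: the polymer of ALL block corners
  satisfies the crux's range-control clause (h4) — (h4) is not a locality condition for large polymers.
* §1 `globalPert ρ hρ b g hg`: the D1 `QuasiLocalGaugePerturbation` with ONE activity `g(S_W(U))` on the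
  whole-torus polymer (cylinder, gauge invariant, measurable, bounded); its total, the (h1) lattice
  symmetries, (h4), and the perturbed measure in the cases `gOne` (`μ_{β,W} = μ_{β₁}`,
  `perturbedMeasure_one`) and `gMix` (`μ_{β,W} = ½ μ_{β₁} + ½ μ_0`, `perturbedMeasure_mix`,
  `expectation_mix`).
-/

noncomputable section

open MeasureTheory Filter Topology
open scoped ENNReal ComplexOrder
open Literature.MathematicalPhysics.QuantumLattice Literature.MathematicalPhysics.AQFT
  Literature.MathematicalPhysics.QuantumFieldTheory

namespace Summit.QuantumFields.QCD.Theorems.RobustYangMills.Negative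

/-! ## §0 Small identities on the torus -/

section Small

variable {d L N : ℕ} {G : Type*} [Group G]

/-- The `1 × 1` rectangle holonomy is the plaquette holonomy. [folklore] -/
theorem rectangleHolonomy_one_one (U : GaugeConfig d L G) (x : Site d L) (i j : Fin d) :
    rectangleHolonomy U x i j 1 1 = plaquetteHolonomy U x i j := by
  simp [rectangleHolonomy, lineHolonomy, plaquetteHolonomy, Site.shift]

omit [Group G] in
/-- The crux's axis-permutation action is the tree's `configPerm`. [folklore] -/
theorem configPerm_eq [MeasurableSpace G] (π : Equiv.Perm (Fin d)) (U : GaugeConfig d L G) :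
    (configPerm π U : GaugeConfig d L G) = fun e => U (e.1 ∘ π, π.symm e.2) := by
  funext e
  rw [configPerm_apply]
  rfl

variable [TopologicalSpace G] [IsTopologicalGroup G] [CompactSpace G]

/-- The Wilson action is invariant under the time reflection `Θ` (any torus size). [folklore] -/
theorem wilsonAction_timeReflect [NeZero d] [NeZero L] (ρ : G →* Matrix (Fin N) (Fin N) ℂ)
    (hρ : Continuous ρ) (U : GaugeConfig d L G) :
    wilsonAction ρ U.timeReflect = wilsonAction ρ U := by
  unfold wilsonAction
  have h : ∀ p : Plaquette d L,
      (ρ (plaquetteHolonomy U.timeReflect p.1 p.2.1.1 p.2.1.2)).trace.re =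
        (ρ (plaquetteHolonomy U (WilsonRP.plaqReflect p).1 (WilsonRP.plaqReflect p).2.1.1
          (WilsonRP.plaqReflect p).2.1.2)).trace.re :=
    fun p => WilsonRP.plaqRe_timeReflect ρ hρ U p
  simp_rw [h]
  exact Fintype.sum_equiv WilsonRP.plaqReflectEquiv _ _ (fun p => rfl)

variable [MeasurableSpace G] [BorelSpace G]

/-- At `β = 0` the torus Wilson measure is the Haar product (any `d`, `L`; cf. the `d = 4`,
universe-`0` version `wilsonMeasure_zero_coupling` of the YangMills negative files). [folklore] -/
theorem wilsonMeasure_zero_eq_pi [NeZero L] (ρ : G →* Matrix (Fin N) (Fin N) ℂ) :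
    wilsonMeasure (d := d) (L := L) ρ 0 = Measure.pi fun _ : Edge d L => haarProbability G := by
  have hW : wilsonWeight (d := d) (L := L) ρ 0 = Measure.pi fun _ : Edge d L => haarProbability G := by
    have h1 : (fun U : GaugeConfig d L G => ENNReal.ofReal (Real.exp (-0 * wilsonAction ρ U))) = 1 := by
      funext U; simp
    simp only [wilsonWeight, h1, withDensity_one]
  have hZ : partitionFunction (d := d) (L := L) ρ 0 = 1 := by
    simp only [partitionFunction, hW, measure_univ]
  rw [wilsonMeasure, hZ, hW, inv_one, one_smul]

/-- The torus partition function is neither `0` nor `∞` (continuous `ρ`). [folklore] -/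
theorem partitionFunction_ne_zero_and_ne_top [NeZero L] (ρ : G →* Matrix (Fin N) (Fin N) ℂ)
    (hρ : Continuous ρ) (β : ℝ) :
    partitionFunction (d := d) (L := L) ρ β ≠ 0 ∧ partitionFunction (d := d) (L := L) ρ β ≠ ∞ := by
  haveI := isProbabilityMeasure_wilsonMeasure (d := d) (L := L) ρ hρ β
  have h1 : wilsonMeasure (d := d) (L := L) ρ β Set.univ = 1 := measure_univ
  have h2 : wilsonMeasure (d := d) (L := L) ρ β Set.univ =
      (partitionFunction (d := d) (L := L) ρ β)⁻¹ * partitionFunction (d := d) (L := L) ρ β := by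
    simp [wilsonMeasure, partitionFunction]
  rw [h2] at h1
  constructor
  · intro h0; rw [h0] at h1; simp at h1
  · intro ht; rw [ht] at h1; simp at h1

end Small

/-! ## §0b Block corners: the whole-torus polymer passes the range-control clause (h4) -/

section Corners

variable {L : ℕ} [NeZero L]

/-- There are at least `⌈L/b⌉` block corners, so `L ≤ b · #corners` for `b ≥ 1`: the range-control
clause (h4) of the crux is satisfied by the polymer of ALL block corners. [folklore] -/
theorem side_le_mul_card_blockCorners {b : ℕ} (hb : 1 ≤ b) :
    L ≤ b * (blockCorners (d := 4) (L := L) b).card := by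
  classical
  set q : ℕ := (L - 1) / b + 1 with hq
  -- the corners `(m b, 0, 0, 0)`, `m < q`
  let f : ℕ → Site 4 L := fun m => Pi.single 0 (((m * b : ℕ) : ZMod L))
  have hL : 0 < L := Nat.pos_of_ne_zero (NeZero.ne L)
  have hmb : ∀ m, m < q → m * b < L := by
    intro m hm
    have hm' : m ≤ (L - 1) / b := Nat.lt_succ_iff.1 hm
    calc m * b ≤ (L - 1) / b * b := Nat.mul_le_mul_right _ hm'
      _ ≤ L - 1 := Nat.div_mul_le_self _ _
      _ < L := Nat.sub_lt hL one_pos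
  have hval : ∀ m, m < q → (f m 0).val = m * b := by
    intro m hm
    simp only [f, Pi.single_eq_same, ZMod.val_natCast]
    exact Nat.mod_eq_of_lt (hmb m hm)
  have hmem : ∀ m, m < q → f m ∈ blockCorners (d := 4) (L := L) b := by
    intro m hm
    rw [mem_blockCorners_iff]
    intro i
    by_cases hi : i = 0
    · subst hi; rw [hval m hm]; exact Dvd.intro_left _ rfl
    · simp [f, hi]
  have hinj : Set.InjOn f ↑(Finset.range q) := by
    intro m hm m' hm' hmm'
    have hmq : m < q := Finset.mem_range.1 hm
    have hmq' : m' < q := Finset.mem_range.1 hm'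
    have := congrArg (fun x : Site 4 L => (x 0).val) hmm'
    rw [hval m hmq, hval m' hmq'] at this
    exact Nat.eq_of_mul_eq_mul_right (by omega) this
  have hcard : q ≤ (blockCorners (d := 4) (L := L) b).card := by
    calc q = (Finset.range q).card := (Finset.card_range q).symm
      _ = ((Finset.range q).image f).card := (Finset.card_image_of_injOn hinj).symm
      _ ≤ _ := Finset.card_le_card (fun x hx => by
          obtain ⟨m, hm, rfl⟩ := Finset.mem_image.1 hx
          exact hmem m (Finset.mem_range.1 hm))
  have hbq : L ≤ b * q := by
    have := Nat.div_add_mod (L - 1) b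
    have hmod : (L - 1) % b < b := Nat.mod_lt _ (by omega)
    have e1 : b * q = b * ((L - 1) / b) + b := by rw [hq]; ring
    rw [e1]
    generalize (L - 1) / b = t at this ⊢
    generalize (L - 1) % b = r at this hmod
    generalize b * t = bt at this ⊢
    omega
  exact hbq.trans (Nat.mul_le_mul_left _ hcard)

/-- On the torus of side `L`, every one-sided `ZMod` difference has representative `< L`, hence
the range-control disjunction holds as soon as `L ≤ b · |X|`. [folklore] -/
theorem rangeControl_of_side_le {b : ℕ} {X : Finset (Site 4 L)} (h : L ≤ b * X.card)
    (y y' : Site 4 L) (i : Fin 4) :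
    (y i - y' i).val ≤ b * X.card ∨ (y' i - y i).val ≤ b * X.card :=
  Or.inl ((ZMod.val_lt _).le.trans h)

end Corners

/-! ## §1 The global one-activity perturbation `X_all ↦ g(S_W(U))` -/

section Global

variable {G : Type*} [Group G] [TopologicalSpace G] [IsTopologicalGroup G] [CompactSpace G]
  [MeasurableSpace G] [BorelSpace G] [SecondCountableTopology G] {N : ℕ}
  (ρ : G →* Matrix (Fin N) (Fin N) ℂ) (hρ : Continuous ρ)

variable {Lt : ℕ} [NeZero Lt]

/-- The quasi-local perturbation with a SINGLE non-zero activity, carried by the polymer of all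
block corners (the whole torus) and equal to `g(S_W(U))` for a continuous `g : ℝ → ℝ`. It is a
legitimate member of D1's class (cylinder: all links; gauge invariant; measurable; bounded). [folklore] -/
def globalPert (b : ℕ) (g : ℝ → ℝ) (hg : Continuous g) : QuasiLocalGaugePerturbation 4 Lt G b where
  act X U := if X = blockCorners b then g (wilsonAction ρ U) else 0
  dependsOn' X := by
    intro U V hUV
    by_cases hX : X = blockCorners b
    · have hUV' : U = V := funext fun e => hUV e (by
        rw [Finset.mem_coe, mem_polymerEdges_iff, hX]
        exact mem_blockCorners_iff.2 (isBlockAligned_blockCorner b e.1))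
      rw [hUV']
    · simp [hX]
  gaugeInvariant' X := by
    intro gauge U
    by_cases hX : X = blockCorners b
    · simp only [hX, ↓reduceIte, wilsonAction_gaugeTransform]
    · simp [hX]
  measurable' X := by
    by_cases hX : X = blockCorners b
    · simp only [hX, ↓reduceIte]
      exact (hg.comp (continuous_wilsonAction ρ hρ)).measurable
    · simp only [hX, ↓reduceIte]
      exact measurable_const
  bounded' X := by
    by_cases hX : X = blockCorners b
    · obtain ⟨C, hC⟩ := (isCompact_univ.image
        (continuous_abs.comp (hg.comp (continuous_wilsonAction (d := 4) (L := Lt) ρ hρ)))).isBounded.bddAbove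
      refine ⟨C, fun U => ?_⟩
      simp only [hX, ↓reduceIte]
      exact hC ⟨U, Set.mem_univ _, rfl⟩
    · exact ⟨0, fun U => by simp [hX]⟩

variable {ρ hρ}

/-- The activity of the global perturbation. [folklore] -/
@[simp] theorem globalPert_act (b : ℕ) (g : ℝ → ℝ) (hg : Continuous g) (X : Finset (Site 4 Lt))
    (U : GaugeConfig 4 Lt G) :
    (globalPert ρ hρ b g hg).act X U = if X = blockCorners b then g (wilsonAction ρ U) else 0 := rfl

/-- Its total is `g(S_W(U))`. [folklore] -/
theorem total_globalPert (b : ℕ) (g : ℝ → ℝ) (hg : Continuous g) (U : GaugeConfig 4 Lt G) :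
    (globalPert ρ hρ b g hg).total U = g (wilsonAction ρ U) := by
  simp [QuasiLocalGaugePerturbation.total, Finset.sum_ite_eq', mem_polymers_iff]

/-- (h1a) the total is invariant under all torus translations. [folklore] -/
theorem total_globalPert_shift (b : ℕ) (g : ℝ → ℝ) (hg : Continuous g) (v : Site 4 Lt)
    (U : GaugeConfig 4 Lt G) :
    (globalPert ρ hρ b g hg).total (torusConfigShift v U) = (globalPert ρ hρ b g hg).total U := by
  rw [total_globalPert, total_globalPert, wilsonAction_torusConfigShift]

/-- (h1b) the total is invariant under the time reflection. [folklore] -/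
theorem total_globalPert_timeReflect (b : ℕ) (g : ℝ → ℝ) (hg : Continuous g)
    (U : GaugeConfig 4 Lt G) :
    (globalPert ρ hρ b g hg).total (GaugeConfig.timeReflect U) = (globalPert ρ hρ b g hg).total U := by
  rw [total_globalPert, total_globalPert, wilsonAction_timeReflect ρ hρ]

/-- (h1c) the total is invariant under all axis permutations. [folklore] -/
theorem total_globalPert_perm (b : ℕ) (g : ℝ → ℝ) (hg : Continuous g) (π : Equiv.Perm (Fin 4))
    (U : GaugeConfig 4 Lt G) :
    (globalPert ρ hρ b g hg).total (fun e => U (e.1 ∘ π, π.symm e.2)) =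
      (globalPert ρ hρ b g hg).total U := by
  rw [← configPerm_eq, total_globalPert, total_globalPert, wilsonAction_configPerm ρ hρ]

/-- (h4) range control: the only activity-carrying polymer is the whole torus, and
`2S+1 ≤ b · #corners`. [folklore] -/
theorem rangeControl_globalPert {b : ℕ} (hb : 1 ≤ b) (g : ℝ → ℝ) (hg : Continuous g)
    (X : Finset (Site 4 Lt)) (hne : ∃ U : GaugeConfig 4 Lt G, (globalPert ρ hρ b g hg).act X U ≠ 0)
    (y : Site 4 Lt) (_hy : y ∈ X) (y' : Site 4 Lt) (_hy' : y' ∈ X) (i : Fin 4) :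
    (y i - y' i).val ≤ b * X.card ∨ (y' i - y i).val ≤ b * X.card := by
  have hX : X = blockCorners b := by
    by_contra h
    obtain ⟨U, hU⟩ := hne
    exact hU (by simp [h])
  subst hX
  exact rangeControl_of_side_le (side_le_mul_card_blockCorners hb) y y' i

/-- The perturbed weight of the global perturbation. [folklore] -/
theorem weight_globalPert (b : ℕ) (g : ℝ → ℝ) (hg : Continuous g) (β : ℝ) :
    (globalPert ρ hρ b g hg).weight ρ β =
      (Measure.pi fun _ : Edge 4 Lt => haarProbability G).withDensity
        fun U => ENNReal.ofReal (Real.exp (-β * wilsonAction ρ U - g (wilsonAction ρ U))) := by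
  unfold QuasiLocalGaugePerturbation.weight
  congr 1
  funext U
  rw [total_globalPert]

/-! ### Case ONE: `g(s) = (β₁ - β) s` — the pure Wilson theory at coupling `β₁` -/

/-- `g(s) = (β₁ - β) s`: shifts the coupling from `β` to `β₁`. [folklore] -/
def gOne (β β₁ : ℝ) : ℝ → ℝ := fun s => (β₁ - β) * s

/-- `gOne` is continuous. [folklore] -/
theorem continuous_gOne (β β₁ : ℝ) : Continuous (gOne β β₁) := by
  unfold gOne; fun_prop

/-- With `g = gOne β β₁` the perturbed measure at coupling `β` IS the Wilson measure at `β₁`. [folklore] -/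
theorem perturbedMeasure_one (b : ℕ) (β β₁ : ℝ) :
    (globalPert ρ hρ b (gOne β β₁) (continuous_gOne β β₁)).perturbedMeasure ρ β =
      wilsonMeasure (d := 4) (L := Lt) ρ β₁ := by
  have hw : (globalPert ρ hρ b (gOne β β₁) (continuous_gOne β β₁)).weight ρ β =
      wilsonWeight (d := 4) (L := Lt) ρ β₁ := by
    rw [weight_globalPert]
    unfold wilsonWeight
    congr 1
    funext U
    congr 2
    simp only [gOne]
    ring
  unfold QuasiLocalGaugePerturbation.perturbedMeasure QuasiLocalGaugePerturbation.partitionFunction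
    wilsonMeasure partitionFunction
  rw [hw]

/-! ### Case MIX: `g(s) = -β s - log(e^{-β₁ s} + z₁)` — the 50/50 mixture of `μ_{β₁}` and Haar -/

/-- `g(s) = -β s - log (exp (-β₁ s) + z)`: turns `e^{-β S}` into `e^{-β₁ S} + z`. [folklore] -/
def gMix (β β₁ z : ℝ) : ℝ → ℝ := fun s => -β * s - Real.log (Real.exp (-β₁ * s) + z)

/-- `e^{-β₁ s} + z > 0` for `z ≥ 0`. [folklore] -/
theorem exp_add_pos (β₁ z : ℝ) (hz : 0 ≤ z) (s : ℝ) : 0 < Real.exp (-β₁ * s) + z :=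
  add_pos_of_pos_of_nonneg (Real.exp_pos _) hz

/-- `gMix` is continuous (`z ≥ 0`). [folklore] -/
theorem continuous_gMix (β β₁ z : ℝ) (hz : 0 ≤ z) : Continuous (gMix β β₁ z) := by
  unfold gMix
  refine (continuous_const.mul continuous_id).sub ?_
  exact Continuous.log (by fun_prop) fun s => (exp_add_pos β₁ z hz s).ne'

/-- With `g = gMix β β₁ z₁`, `z₁ = Z_{β₁}`, the perturbed measure at coupling `β` is the mixture
`½ μ_{β₁} + ½ μ_0`. [folklore] -/
theorem perturbedMeasure_mix (b : ℕ) (β β₁ : ℝ) :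
    (globalPert ρ hρ b (gMix β β₁ (partitionFunction (d := 4) (L := Lt) ρ β₁).toReal)
        (continuous_gMix β β₁ _ ENNReal.toReal_nonneg)).perturbedMeasure ρ β =
      (2⁻¹ : ℝ≥0∞) • wilsonMeasure (d := 4) (L := Lt) ρ β₁ +
        (2⁻¹ : ℝ≥0∞) • wilsonMeasure (d := 4) (L := Lt) ρ 0 := by
  set Z₁ : ℝ≥0∞ := partitionFunction (d := 4) (L := Lt) ρ β₁ with hZ₁
  obtain ⟨hZ0, hZt⟩ := partitionFunction_ne_zero_and_ne_top (d := 4) (L := Lt) ρ hρ β₁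
  set π₀ : Measure (GaugeConfig 4 Lt G) := Measure.pi fun _ : Edge 4 Lt => haarProbability G with hπ₀
  have hmeasS : Measurable fun U : GaugeConfig 4 Lt G => ENNReal.ofReal (Real.exp (-β₁ * wilsonAction ρ U)) :=
    ENNReal.measurable_ofReal.comp ((continuous_wilsonAction ρ hρ).measurable.const_mul (-β₁)).exp
  -- the weight is `wilsonWeight β₁ + Z₁ • π₀`
  have hw : (globalPert ρ hρ b (gMix β β₁ Z₁.toReal)
      (continuous_gMix β β₁ _ ENNReal.toReal_nonneg)).weight ρ β =
      wilsonWeight (d := 4) (L := Lt) ρ β₁ + Z₁ • π₀ := by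
    rw [weight_globalPert]
    have hdens : (fun U : GaugeConfig 4 Lt G => ENNReal.ofReal
        (Real.exp (-β * wilsonAction ρ U - gMix β β₁ Z₁.toReal (wilsonAction ρ U)))) =
        (fun U => ENNReal.ofReal (Real.exp (-β₁ * wilsonAction ρ U))) + fun _ => Z₁ := by
      funext U
      simp only [Pi.add_apply, gMix]
      rw [show -β * wilsonAction ρ U - (-β * wilsonAction ρ U -
          Real.log (Real.exp (-β₁ * wilsonAction ρ U) + Z₁.toReal)) =
          Real.log (Real.exp (-β₁ * wilsonAction ρ U) + Z₁.toReal) by ring,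
        Real.exp_log (exp_add_pos β₁ _ ENNReal.toReal_nonneg _),
        ENNReal.ofReal_add (Real.exp_pos _).le ENNReal.toReal_nonneg, ENNReal.ofReal_toReal hZt]
    rw [hdens, withDensity_add_left hmeasS, withDensity_const]
    rfl
  have hZW : (globalPert (Lt := Lt) ρ hρ b (gMix β β₁ Z₁.toReal)
      (continuous_gMix β β₁ _ ENNReal.toReal_nonneg)).partitionFunction ρ β = 2 * Z₁ := by
    unfold QuasiLocalGaugePerturbation.partitionFunction
    have hπu : π₀ Set.univ = 1 := by rw [hπ₀]; exact measure_univ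
    rw [hw, Measure.add_apply, Measure.smul_apply, hπu, smul_eq_mul, mul_one]
    change Z₁ + Z₁ = 2 * Z₁
    rw [two_mul]
  unfold QuasiLocalGaugePerturbation.perturbedMeasure
  rw [hZW, hw, smul_add, smul_smul, ENNReal.mul_inv (Or.inl two_ne_zero) (Or.inl ENNReal.ofNat_ne_top),
    mul_assoc, ENNReal.inv_mul_cancel hZ0 hZt, mul_one]
  congr 1
  · unfold wilsonMeasure
    rw [smul_smul]
  · rw [wilsonMeasure_zero_eq_pi (d := 4) (L := Lt) ρ]

/-- Expectations under the mixture split. [folklore] -/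
theorem expectation_mix {V : Type*} [NormedAddCommGroup V] [NormedSpace ℝ V] [CompleteSpace V]
    (b : ℕ) (β β₁ : ℝ)
    (f : GaugeConfig 4 Lt G → V) (h₁ : Integrable f (wilsonMeasure (d := 4) (L := Lt) ρ β₁))
    (h₀ : Integrable f (wilsonMeasure (d := 4) (L := Lt) ρ 0)) :
    (globalPert ρ hρ b (gMix β β₁ (partitionFunction (d := 4) (L := Lt) ρ β₁).toReal)
        (continuous_gMix β β₁ _ ENNReal.toReal_nonneg)).expectation ρ β f =
      (2⁻¹ : ℝ) • (∫ U, f U ∂(wilsonMeasure (d := 4) (L := Lt) ρ β₁)) +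
        (2⁻¹ : ℝ) • ∫ U, f U ∂(wilsonMeasure (d := 4) (L := Lt) ρ 0) := by
  unfold QuasiLocalGaugePerturbation.expectation
  rw [perturbedMeasure_mix, integral_add_measure (h₁.smul_measure (by simp)) (h₀.smul_measure (by simp)),
    integral_smul_measure, integral_smul_measure]
  norm_num

end Global

end Summit.QuantumFields.QCD.Theorems.RobustYangMills.Negative
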